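import Summits.Ventures.PercRepro.RankLevelSetUpFiveSimple

/-! # RankLevelSetUpFivePreimage — A TYPE-B TARGET HAS AT MOST FIVE BAD PREIMAGES ON A SIMPLE MATROID
(night-1 g44; dossier §56.5; on `RankLevelSetUpFiveSimple`)

The other half of the swap count of §56.5. A bad member `W` (a base through `b` with complement `C ⊔ L'`: three
coloops `C` and a four-point line `L'` of rank `2` disjoint from `cl L' ∩ W`) sends to the pairs `(Z, t)` with
`Z = (W ∖ b) ∪ {ℓ, c}`, `ℓ ∈ L'`, `c ∈ C`, `t ∈ C ∖ c`. Given `(Z, t)`, the set `X := (E ∖ Z) ∖ {b, t}` is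
`(L' ∖ ℓ) ∪ {c''}` with `c''` the third coloop, and the line point `ℓ` is THE element `z ∈ Z` such that some
three-element `T ⊆ X` has `rk (T ∪ z) ≤ 2` (**`line_point_eq_of_eRk_le_two`**: a triple containing `c''` has rank `3`
on a simple matroid, and the triple `L' ∖ ℓ` closes to the line, which meets `Z` in `ℓ` alone). So every bad
preimage of `(Z, t)` has the SAME line point `ℓ₀`, `W ↦ Z ∖ W = {ℓ₀, c}` is injective, and there are at most
`#(Z ∖ ℓ₀) = 5` preimages (**`ncard_preimages_le_five`**). Every declaration has a docstring; imports: the cell's own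
modules and Mathlib only. Axioms: standard. -/

namespace PercRepro

open Set Matroid

variable {α : Type}

/-- **A subset of a simple matroid of rank `≤ 2` and size `≥ 2` has rank exactly `2`-or-more, so a point whose
insertion keeps the rank `≤ 2` lies in its closure.** -/
lemma mem_closure_of_eRk_insert_le_two {N : Matroid α} [N.Finite] (hnl : ∀ e ∈ N.E, N.IsNonloop e)
    (hs : ∀ p ∈ N.E, ∀ q ∈ N.E, p ≠ q → q ∉ N.closure {p}) {T : Set α} (hTE : T ⊆ N.E) (hT : 1 < T.ncard)
    {z : α} (hz : z ∈ N.E) (hr : N.eRk (insert z T) ≤ 2) : z ∈ N.closure T := by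
  by_contra hcon
  have h2 : 2 ≤ N.eRk T :=
    two_le_eRk_of_one_lt_ncard_of_simple hTE (fun e he => hnl e (hTE he))
      (fun p hp q hq => hs p (hTE hp) q (hTE hq)) hT
  have hins : N.eRk (insert z T) = N.eRk T + 1 := Matroid.eRk_insert_eq_add_one ⟨hz, hcon⟩
  have h3 : (3 : ℕ∞) ≤ N.eRk (insert z T) := by
    rw [hins]
    calc (3 : ℕ∞) = 2 + 1 := by norm_num
      _ ≤ N.eRk T + 1 := by gcongr
  have h32 : (3 : ℕ∞) ≤ 2 := h3.trans hr
  have h32' : (3 : ℕ) ≤ 2 := by exact_mod_cast h32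
  omega

/-- **THE LINE POINT OF A TYPE-B TARGET IS DETERMINED BY `(Z, t)`** (night-1 g44, §56.5): `N` loopless and simple;
`W ⊆ E` a set through `b` whose complement is `C ⊔ L'` with `#C = 3`, `L'` of rank `2` with four points, every
element of `C` a coloop of `N|(E ∖ W)` (off the closure of the rest of `E ∖ W`), and `W` disjoint from `cl L'`;
`ℓ ∈ L'`, `c ∈ C`, `t ∈ C ∖ c`, `Z := (W ∖ b) ∪ {ℓ, c}`. If `z ∈ Z` and `T ⊆ (E ∖ Z) ∖ {b, t}` is a triple with
`rk (T ∪ z) ≤ 2`, then `z = ℓ`. -/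
theorem line_point_eq_of_eRk_le_two {N : Matroid α} [N.Finite] (hnl : ∀ e ∈ N.E, N.IsNonloop e)
    (hs : ∀ p ∈ N.E, ∀ q ∈ N.E, p ≠ q → q ∉ N.closure {p}) {W C L' : Set α} {b ℓ c t : α}
    (hWE : W ⊆ N.E) (_hb : b ∈ W) (hY : N.E \ W = C ∪ L') (hdj : Disjoint C L') (hC3 : C.ncard = 3)
    (_hL2 : N.eRk L' = 2) (_hL4 : L'.ncard = 4) (hcol : ∀ x ∈ C, x ∉ N.closure ((N.E \ W) \ {x}))
    (hWL : Disjoint W (N.closure L')) (hℓ : ℓ ∈ L') (hc : c ∈ C) (ht : t ∈ C \ {c})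
    {z : α} (hz : z ∈ (W \ {b}) ∪ {ℓ, c}) {T : Set α} (hT : T ⊆ (N.E \ ((W \ {b}) ∪ {ℓ, c})) \ {b, t})
    (hT3 : T.ncard = 3) (hr : N.eRk (insert z T) ≤ 2) : z = ℓ := by
  classical
  have hCE : C ⊆ N.E := fun x hx => (hY ▸ (Set.mem_union_left L' hx) : x ∈ N.E \ W).1
  have hLE : L' ⊆ N.E := fun x hx => (hY ▸ (Set.mem_union_right C hx) : x ∈ N.E \ W).1
  have hCW : ∀ x ∈ C, x ∉ W := fun x hx => (hY ▸ (Set.mem_union_left L' hx) : x ∈ N.E \ W).2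
  have hLW : ∀ x ∈ L', x ∉ W := fun x hx => (hY ▸ (Set.mem_union_right C hx) : x ∈ N.E \ W).2
  have hLfin : L'.Finite := N.ground_finite.subset hLE
  have hCfin : C.Finite := N.ground_finite.subset hCE
  have hTfin : T.Finite := N.ground_finite.subset (fun x hx => (hT hx).1.1)
  -- the coloops are off `cl L'`
  have hcL : ∀ x ∈ C, x ∉ N.closure L' := by
    intro x hx hxL
    apply hcol x hx
    refine N.closure_subset_closure ?_ hxL
    intro y hy
    exact ⟨hY ▸ Set.mem_union_right C hy, fun hyx => hdj.notMem_of_mem_right hy (hyx ▸ hx)⟩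
  -- `Z ∩ cl L' = {ℓ}`
  have hZL : ∀ y ∈ (W \ {b}) ∪ {ℓ, c}, y ∈ N.closure L' → y = ℓ := by
    intro y hy hyL
    rcases hy with hyW | hy
    · exact absurd hyL (hWL.notMem_of_mem_left hyW.1)
    · rcases hy with rfl | rfl
      · rfl
      · exact absurd hyL (hcL _ hc)
  -- `T` lies in `(L' ∖ ℓ) ∪ (C ∖ {c, t})`
  have hTsub : ∀ x ∈ T, x ∈ L' \ {ℓ} ∨ x ∈ C \ {c, t} := by
    intro x hx
    obtain ⟨⟨hxE, hxZ⟩, hxbt⟩ := hT hx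
    have hxW : x ∈ N.E \ W := by
      refine ⟨hxE, fun hxW' => hxZ (Set.mem_union_left _ ⟨hxW', ?_⟩)⟩
      intro hxb
      exact hxbt (Or.inl hxb)
    rw [hY] at hxW
    rcases hxW with hxC | hxL
    · right
      refine ⟨hxC, ?_⟩
      intro hxct
      rcases hxct with rfl | rfl
      · exact hxZ (Set.mem_union_right _ (Set.mem_insert_of_mem _ rfl))
      · exact hxbt (Or.inr rfl)
    · left
      refine ⟨hxL, fun hxℓ => hxZ ?_⟩
      rw [Set.mem_singleton_iff] at hxℓ
      subst hxℓ
      exact Set.mem_union_right _ (Set.mem_insert _ _)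
  -- `C ∖ {c, t}` is a single element
  have hct : t ≠ c := fun h => ht.2 (h ▸ rfl)
  have hC1 : (C \ {c, t}).ncard = 1 := by
    have h1 : (C \ {c, t}) = (C \ {c}) \ {t} := by
      ext x; simp only [Set.mem_sdiff, Set.mem_insert_iff, Set.mem_singleton_iff, not_or]; tauto
    rw [h1, Set.ncard_sdiff_singleton_of_mem ht, Set.ncard_sdiff_singleton_of_mem hc, hC3]
  have hzE : z ∈ N.E := by
    rcases hz with hzW | hz
    · exact hWE hzW.1
    · rcases hz with rfl | rfl
      · exact hLE hℓ
      · exact hCE hc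
  by_cases hTL : T ⊆ L' \ {ℓ}
  · -- the triple is on the line: `z ∈ cl T ⊆ cl L'`, so `z = ℓ`
    have hzT : z ∈ N.closure T :=
      mem_closure_of_eRk_insert_le_two hnl hs (hTL.trans (Set.sdiff_subset.trans hLE)) (by omega) hzE hr
    exact hZL z hz (N.closure_subset_closure (hTL.trans Set.sdiff_subset) hzT)
  · -- the triple contains the third coloop `x`: its rank is `3`
    obtain ⟨x, hxT, hxL⟩ := Set.not_subset.mp hTL
    have hxC : x ∈ C \ {c, t} := by
      rcases hTsub x hxT with h | h
      · exact absurd h hxL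
      · exact h
    have hrest : T \ {x} ⊆ L' \ {ℓ} := by
      intro y hy
      rcases hTsub y hy.1 with h | h
      · exact h
      · exfalso
        apply hy.2
        have h1 : (C \ {c, t}) = {x} := by
          rw [Set.ncard_eq_one] at hC1
          obtain ⟨a, ha⟩ := hC1
          have hx' : x ∈ ({a} : Set α) := ha ▸ hxC
          rw [Set.mem_singleton_iff] at hx'
          rw [ha, hx']
        have : y ∈ ({x} : Set α) := h1 ▸ h
        exact this
    have hrest2 : (T \ {x}).ncard = 2 := by
      rw [Set.ncard_sdiff_singleton_of_mem hxT, hT3]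
    have hxcl : x ∉ N.closure (T \ {x}) := by
      intro hxcl
      apply hcL x hxC.1
      exact N.closure_subset_closure (hrest.trans Set.sdiff_subset) hxcl
    have hxE : x ∈ N.E := hCE hxC.1
    have hins : N.eRk (insert x (T \ {x})) = N.eRk (T \ {x}) + 1 :=
      Matroid.eRk_insert_eq_add_one ⟨hxE, hxcl⟩
    rw [Set.insert_sdiff_singleton, Set.insert_eq_of_mem hxT] at hins
    have h2 : 2 ≤ N.eRk (T \ {x}) :=
      two_le_eRk_of_one_lt_ncard_of_simple (fun y hy => (hT hy.1).1.1)
        (fun e he => hnl e (hT he.1).1.1) (fun p hp q hq => hs p (hT hp.1).1.1 q (hT hq.1).1.1) (by omega)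
    have h3 : (3 : ℕ∞) ≤ N.eRk T := by
      rw [hins]
      calc (3 : ℕ∞) = 2 + 1 := by norm_num
        _ ≤ N.eRk (T \ {x}) + 1 := by gcongr
    have hTz : N.eRk T ≤ N.eRk (insert z T) := N.eRk_mono (Set.subset_insert z T)
    have h32 : (3 : ℕ∞) ≤ 2 := (h3.trans hTz).trans hr
    have h32' : (3 : ℕ) ≤ 2 := by exact_mod_cast h32
    omega

/-- **AT MOST FIVE BAD PREIMAGES** (night-1 g44, §56.5): `N` loopless and simple, `Z` a six-element set avoiding `b`,
`t` an element, and `𝒲` a family of sets `W` each of which is a bad member (the decomposition of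
`line_point_eq_of_eRk_le_two`) with `(Z, t)` among its type-B targets. Then `#𝒲 ≤ 5`: all members share the line
point `ℓ₀`, and `W ↦ Z ∖ W = {ℓ₀, c_W}` is injective into the five pairs `{ℓ₀, c}`, `c ∈ Z ∖ ℓ₀`. -/
theorem ncard_preimages_le_five {N : Matroid α} [N.Finite] (hnl : ∀ e ∈ N.E, N.IsNonloop e)
    (hs : ∀ p ∈ N.E, ∀ q ∈ N.E, p ≠ q → q ∉ N.closure {p}) {b t : α} {Z : Set α} (hZ : Z.ncard = 6)
    (hbZ : b ∉ Z) (hZE : Z ⊆ N.E) (𝒲 : Set (Set α))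
    (h𝒲 : ∀ W ∈ 𝒲, W ⊆ N.E ∧ b ∈ W ∧ ∃ C L' ℓ c, N.E \ W = C ∪ L' ∧ Disjoint C L' ∧ C.ncard = 3 ∧
      N.eRk L' = 2 ∧ L'.ncard = 4 ∧ (∀ x ∈ C, x ∉ N.closure ((N.E \ W) \ {x})) ∧ Disjoint W (N.closure L') ∧
      ℓ ∈ L' ∧ c ∈ C ∧ t ∈ C \ {c} ∧ Z = (W \ {b}) ∪ {ℓ, c}) :
    𝒲.ncard ≤ 5 := by
  classical
  have hZfin : Z.Finite := N.ground_finite.subset hZE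
  rcases 𝒲.eq_empty_or_nonempty with h𝒲e | ⟨W₀, hW₀⟩
  · rw [h𝒲e, Set.ncard_empty]; omega
  obtain ⟨hW₀E, hbW₀, C₀, L₀, ℓ₀, c₀, hY₀, hdj₀, hC₀, hL₀, hL₀4, hcol₀, hWL₀, hℓ₀, hc₀, ht₀, hZ₀⟩ :=
    h𝒲 W₀ hW₀
  have hL₀E : L₀ ⊆ N.E := fun x hx => (hY₀ ▸ (Set.mem_union_right C₀ hx) : x ∈ N.E \ W₀).1
  have hℓ₀Z : ℓ₀ ∈ Z := hZ₀ ▸ Set.mem_union_right _ (Set.mem_insert _ _)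
  -- every member has line point `ℓ₀`
  have hsame : ∀ W ∈ 𝒲, ∀ C L' ℓ c, N.E \ W = C ∪ L' → Disjoint C L' → C.ncard = 3 → N.eRk L' = 2 →
      L'.ncard = 4 → (∀ x ∈ C, x ∉ N.closure ((N.E \ W) \ {x})) → Disjoint W (N.closure L') → ℓ ∈ L' →
      c ∈ C → t ∈ C \ {c} → Z = (W \ {b}) ∪ {ℓ, c} → ℓ = ℓ₀ := by
    intro W hW C L' ℓ c hY hdj hC3 hL2 hL4 hcol hWL hℓ hc ht hZW
    obtain ⟨hWE, hbW, -⟩ := h𝒲 W hW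
    -- the triple `T := L₀ ∖ ℓ₀` sits in `(E ∖ Z) ∖ {b, t}` and closes the line of `W₀` with `ℓ₀`
    have hT : L₀ \ {ℓ₀} ⊆ (N.E \ ((W \ {b}) ∪ {ℓ, c})) \ {b, t} := by
      intro x hx
      have hxE : x ∈ N.E := hL₀E hx.1
      have hxW₀ : x ∉ W₀ := (hY₀ ▸ (Set.mem_union_right C₀ hx.1) : x ∈ N.E \ W₀).2
      have hxZ : x ∉ Z := by
        rw [hZ₀]
        rintro (hxW | hx')
        · exact hxW₀ hxW.1
        · rcases hx' with rfl | rfl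
          · exact hx.2 rfl
          · exact hdj₀.notMem_of_mem_left hc₀ hx.1
      refine ⟨⟨hxE, hZW ▸ hxZ⟩, ?_⟩
      rintro (rfl | rfl)
      · exact hxW₀ hbW₀
      · exact hdj₀.notMem_of_mem_left ht₀.1 hx.1
    have hT3 : (L₀ \ {ℓ₀}).ncard = 3 := by
      rw [Set.ncard_sdiff_singleton_of_mem hℓ₀, hL₀4]
    have hr : N.eRk (insert ℓ₀ (L₀ \ {ℓ₀})) ≤ 2 := by
      rw [Set.insert_sdiff_singleton, Set.insert_eq_of_mem hℓ₀, hL₀]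
    have hℓ₀Z' : ℓ₀ ∈ (W \ {b}) ∪ {ℓ, c} := hZW ▸ hℓ₀Z
    exact (line_point_eq_of_eRk_le_two hnl hs hWE hbW hY hdj hC3 hL2 hL4 hcol hWL hℓ hc ht hℓ₀Z' hT hT3
      hr).symm
  -- the injection `W ↦ Z ∖ W` into the pairs `{ℓ₀, c}`
  have hinj : Set.InjOn (fun W : Set α => Z \ W) 𝒲 := by
    intro W hW W' hW' heq
    obtain ⟨-, hbW, C, L', ℓ, c, -, -, -, -, -, -, -, -, -, -, hZW⟩ := h𝒲 W hW
    obtain ⟨-, hbW', C', L'', ℓ', c', -, -, -, -, -, -, -, -, -, -, hZW'⟩ := h𝒲 W' hW'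
    simp only at heq
    have hWZ : W = (Z \ (Z \ W)) ∪ {b} := by
      ext x
      simp only [Set.mem_union, Set.mem_sdiff, Set.mem_singleton_iff, not_and, not_not]
      constructor
      · intro hx
        by_cases hxb : x = b
        · exact Or.inr hxb
        · exact Or.inl ⟨hZW ▸ Set.mem_union_left _ ⟨hx, hxb⟩, fun _ => hx⟩
      · rintro (⟨hxZ, hx⟩ | rfl)
        · exact hx hxZ
        · exact hbW
    have hWZ' : W' = (Z \ (Z \ W')) ∪ {b} := by
      ext x
      simp only [Set.mem_union, Set.mem_sdiff, Set.mem_singleton_iff, not_and, not_not]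
      constructor
      · intro hx
        by_cases hxb : x = b
        · exact Or.inr hxb
        · exact Or.inl ⟨hZW' ▸ Set.mem_union_left _ ⟨hx, hxb⟩, fun _ => hx⟩
      · rintro (⟨hxZ, hx⟩ | rfl)
        · exact hx hxZ
        · exact hbW'
    rw [hWZ, hWZ', heq]
  have hmaps : ∀ W ∈ 𝒲, Z \ W ∈ (fun c : α => ({ℓ₀, c} : Set α)) '' (Z \ {ℓ₀}) := by
    intro W hW
    obtain ⟨hWE, hbW, C, L', ℓ, c, hY, hdj, hC3, hL2, hL4, hcol, hWL, hℓ, hc, ht, hZW⟩ := h𝒲 W hW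
    have hℓℓ₀ : ℓ = ℓ₀ := hsame W hW C L' ℓ c hY hdj hC3 hL2 hL4 hcol hWL hℓ hc ht hZW
    have hℓW : ℓ ∉ W := (hY ▸ (Set.mem_union_right C hℓ) : ℓ ∈ N.E \ W).2
    have hcW : c ∉ W := (hY ▸ (Set.mem_union_left L' hc) : c ∈ N.E \ W).2
    have hcℓ : c ≠ ℓ := fun h => hdj.notMem_of_mem_left hc (h ▸ hℓ)
    have hZW' : Z \ W = {ℓ, c} := by
      rw [hZW]
      ext x
      constructor
      · rintro ⟨hx, hxW⟩
        rcases hx with hx | hx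
        · exact absurd hx.1 hxW
        · exact hx
      · intro hx
        rcases hx with rfl | rfl
        · exact ⟨Or.inr (Or.inl rfl), hℓW⟩
        · exact ⟨Or.inr (Or.inr rfl), hcW⟩
    refine ⟨c, ⟨hZW ▸ Set.mem_union_right _ (Set.mem_insert_of_mem _ rfl), hℓℓ₀ ▸ hcℓ⟩, ?_⟩
    show ({ℓ₀, c} : Set α) = Z \ W
    rw [hZW', hℓℓ₀]
  have himg : ((fun c : α => ({ℓ₀, c} : Set α)) '' (Z \ {ℓ₀})).ncard ≤ 5 := by
    refine le_trans (Set.ncard_image_le (hZfin.subset Set.sdiff_subset)) ?_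
    rw [Set.ncard_sdiff_singleton_of_mem hℓ₀Z, hZ]
  exact le_trans (Set.ncard_le_ncard_of_injOn _ hmaps hinj
    ((hZfin.subset Set.sdiff_subset).image _)) himg

end PercRepro
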